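import Mathlib
import Literature.AlgebraicGeometry.Morphisms.CechH1AffineProofs
import Literature.AlgebraicGeometry.Morphisms.CechH1Refinement
import HarnessLib

/-!
# `Ȟ¹(𝒰, 𝒪_X)` is torsion for a function `y` whose non-vanishing locus `X_y` is affine

Topic: `Literature/AlgebraicGeometry/Morphisms`.  For a scheme `f : X → Spec A` over a ring `A`, a finite
family `𝒰 = (U_i)` of affine opens covering `X` with affine pairwise intersections (e.g. `X` separated), and
an element `y ∈ A` such that the open `X_y = D(f^* y) ⊆ X` is AFFINE, every class of the first Čech
cohomology `Ȟ¹(𝒰, 𝒪_X)` (`Morphisms/CechH1`) is killed by a power of `y`: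

* `CechH1.exists_pow_smul_eq_zero_of_isAffineOpen_basicOpen` — `∀ ξ, ∃ n, yⁿ • ξ = 0`.

This is the elementary content of «cohomology commutes with flat base change» for the localisation
`A → A_y` in degree one (The Stacks Project, Tag 02KH; Görtz–Wedhorn II, Cor. 22.91), in the only form the
tree needs: `Ȟ¹(𝒰, 𝒪_X) ⊗_A A_y ↪ Ȟ¹(𝒰 ∩ X_y, 𝒪_{X_y}) = 0` since `X_y` is affine (Görtz–Wedhorn II,
Lemma 22.1: the Čech cohomology of `𝒪` of ANY family of opens covering an affine open vanishes — the tree's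
`cechH1_affine_vanishing_holds`).  Proof, on cochains: restrict a cocycle `c` on `𝒰` to the family
`W_i = U_i ∩ X_y = D(y|_{U_i})`, which covers the affine `X_y`, so `c|_W = d⁰ b`; write
`b_i = a_i / y^{N}` with `a_i ∈ Γ(U_i)` (`Γ(D(y|_{U_i})) = Γ(U_i)_y`, Mathlib
`IsAffineOpen.isLocalization_basicOpen` through the tree's `exists_res_eq_pow_mul`); then
`y^N c - d⁰ a` vanishes on the `D(y|_{U_i ∩ U_j})`, hence is killed by `y^M` on the affine `U_i ∩ U_j`
(`exists_pow_mul_eq_zero`), i.e. `y^{M+N} c = d⁰(y^M a)` is a coboundary.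

Use (cell res-hironaka, kill test `SurfaceTermination` of route `HomologicalConductor`): for a resolution
`X → Spec T` of a two-dimensional normal local domain and `y ∈ 𝔪_T ∖ 0`, `X_y ≅ D(y)` is affine (the
resolution is an isomorphism over the punctured spectrum), so `Ȟ¹(𝒰, 𝒪_X)` is `𝔪`-power torsion and —
being finitely generated (`cechH1_finite`) — of finite length: the geometric genus is finite.

Everything is proved; no named facts; no definitions.  Mathlib searched (pin): `Scheme.basicOpen_res`,
`Scheme.basicOpen_le`, `Scheme.basicOpen_mul`, `IsAffineOpen.basicOpen`, `iSup_inf_eq` (used); Mathlib has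
no Čech cohomology of schemes.

## References

* U. Görtz, T. Wedhorn, *Algebraic Geometry II: Cohomology of Schemes* (2023): Lemma 22.1 (p. 327),
  Cor. 22.91 (flat base change). [GortzWedhorn2023]
* The Stacks Project, Tag 02KH (flat base change), Tag 01XD. [StacksProject]
-/

noncomputable section

open CategoryTheory AlgebraicGeometry TopologicalSpace Opposite

universe u

namespace Literature.AlgebraicGeometry.Morphisms

variable {A : Type u} [CommRing A] {X : Scheme.{u}} (f : X ⟶ Spec (.of A))
variable {ι : Type u} (U : ι → X.Opens)

/-- The action of `a ∈ A` on a `1`-cochain is multiplication by the restricted global section `f^* a`.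
[folklore] -/
private theorem smul_cechC1_apply (a : A) (c : CechC1 f U) (i j : ι) :
    (a • c) i j = Sections.res f (le_top : U i ⊓ U j ≤ ⊤) (algebraMapΓ f a) * c i j := by
  rw [Pi.smul_apply, Pi.smul_apply, Algebra.smul_def]
  rfl

/-- **`Ȟ¹(𝒰, 𝒪_X)` is `y`-power torsion when `X_y` is affine.**  Let `f : X → Spec A`, `𝒰 = (U_i)_{i ∈ ι}`
a finite family of affine opens covering `X` with affine pairwise intersections, and `y ∈ A` such that the
non-vanishing locus `X.basicOpen (f^* y)` is an affine open.  Then every class `ξ ∈ Ȟ¹(𝒰, 𝒪_X)` satisfies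
`yⁿ • ξ = 0` for some `n`.  (Degree-one Čech form of flat base change to `A_y` plus the vanishing of `Ȟ¹` on
the affine `X_y`.) [cite: GortzWedhorn2023, Lemma 22.1 (p. 327)] -/
theorem CechH1.exists_pow_smul_eq_zero_of_isAffineOpen_basicOpen [Finite ι]
    (hU : ∀ i, IsAffineOpen (U i)) (hU2 : ∀ i j, IsAffineOpen (U i ⊓ U j)) (hcov : ⨆ i, U i = ⊤)
    (y : A) (hy : IsAffineOpen (X.basicOpen (algebraMapΓ f y))) (ξ : CechH1 f U) :
    ∃ n : ℕ, y ^ n • ξ = 0 := by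
  classical
  haveI : Fintype ι := Fintype.ofFinite ι
  set s : Sections f ⊤ := algebraMapΓ f y with hsdef
  -- the restricted sections `r i = s|_{U i}` (as elements of the `A`-algebras `Sections f (U i)`)
  let r : ∀ i, Sections f (U i) := fun i => Sections.res f (le_top : U i ≤ ⊤) s
  -- the principal opens `W i = D(r i) = U i ∩ X_s`
  let W : ι → X.Opens := fun i => X.basicOpen (r i)
  have hWU : ∀ i, W i ≤ U i := fun i => X.basicOpen_le (r i)
  have hWeq : ∀ i, W i = U i ⊓ X.basicOpen s := fun i => by
    change X.basicOpen (X.presheaf.map (homOfLE (le_top : U i ≤ ⊤)).op s) = _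
    rw [Scheme.basicOpen_res]
  have hWcov : ⨆ i, W i = X.basicOpen s := by
    simp_rw [hWeq]
    rw [← iSup_inf_eq, hcov, top_inf_eq]
  -- the class restricted to `W` vanishes: `W` covers the affine `X_s`
  obtain ⟨z, rfl⟩ := CechH1.mk_surjective f U ξ
  have hvan : cechRefineC1 f U W id hWU (z : CechC1 f U) ∈ cechB1 f W :=
    cechH1_affine_vanishing_holds f hy W hWcov (refineC1_mem_cechZ1 f U W id hWU z.2)
  obtain ⟨b, hb⟩ := (mem_cechB1_iff f W _).mp hvan
  -- numerators: `a i |_{W i} = (r i)^(n i) |_{W i} * b i`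
  have hnum : ∀ i, ∃ (n : ℕ) (a : Sections f (U i)),
      Sections.res f (hWU i) a = Sections.res f (hWU i) (r i) ^ n * b i :=
    fun i => exists_res_eq_pow_mul f (hU i) (r i) rfl (b i)
  choose n a ha using hnum
  obtain ⟨N, hN⟩ : ∃ N, ∀ i, n i ≤ N :=
    ⟨Finset.univ.sup n, fun i => Finset.le_sup (Finset.mem_univ i)⟩
  -- uniform exponent: `a' i |_{W i} = (r i)^N |_{W i} * b i`
  let a' : CechC0 f U := fun i => r i ^ (N - n i) * a i
  have ha' : ∀ i, Sections.res f (hWU i) (a' i) = Sections.res f (hWU i) (r i) ^ N * b i := by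
    intro i
    change Sections.res f (hWU i) (r i ^ (N - n i) * a i) = _
    rw [map_mul, map_pow, ha i, ← mul_assoc, ← pow_add, Nat.sub_add_cancel (hN i)]
  -- the cochain `e = y^N • z - d⁰ a'` vanishes on each `W i ∩ W j`
  have hUU : ∀ i j, U i ⊓ U j ≤ ⊤ := fun _ _ => le_top
  have hWW : ∀ i j, W i ⊓ W j ≤ U i ⊓ U j := fun i j => inf_le_inf (hWU i) (hWU j)
  have hsN : (algebraMapΓ f (y ^ N) : Sections f ⊤) = s ^ N := map_pow (algebraMapΓ f) y N
  have hvanish : ∀ i j, Sections.res f (hWW i j)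
      ((y ^ N • (z : CechC1 f U)) i j - cechD0 f U a' i j) = 0 := by
    intro i j
    -- canonical restricted section of `s` on `W i ∩ W j`
    set sV : Sections f (W i ⊓ W j) := Sections.res f (le_top : W i ⊓ W j ≤ ⊤) s with hsV
    -- `d⁰ b = z|_W` at `(i, j)`
    have hbij : Sections.res f (inf_le_right : W i ⊓ W j ≤ W j) (b j) -
        Sections.res f (inf_le_left : W i ⊓ W j ≤ W i) (b i) =
        Sections.res f (hWW i j) ((z : CechC1 f U) i j) := by
      have := congrFun (congrFun hb i) j
      rw [cechD0_apply] at this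
      rw [this, cechRefineC1_apply]
      rfl
    -- the smul term
    have e1 : Sections.res f (hWW i j) ((y ^ N • (z : CechC1 f U)) i j) =
        sV ^ N * Sections.res f (hWW i j) ((z : CechC1 f U) i j) := by
      rw [smul_cechC1_apply, map_mul, Sections.res_res, hsN, map_pow]
    -- the two `a'` terms
    have eaj : Sections.res f (hWW i j) (Sections.res f (inf_le_right : U i ⊓ U j ≤ U j) (a' j)) =
        sV ^ N * Sections.res f (inf_le_right : W i ⊓ W j ≤ W j) (b j) := by
      rw [Sections.res_res, ← Sections.res_res f (hWU j) (inf_le_right : W i ⊓ W j ≤ W j), ha' j,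
        map_mul, map_pow, Sections.res_res]
      congr 2
      change Sections.res f _ (Sections.res f _ s) = _
      rw [Sections.res_res]
    have eai : Sections.res f (hWW i j) (Sections.res f (inf_le_left : U i ⊓ U j ≤ U i) (a' i)) =
        sV ^ N * Sections.res f (inf_le_left : W i ⊓ W j ≤ W i) (b i) := by
      rw [Sections.res_res, ← Sections.res_res f (hWU i) (inf_le_left : W i ⊓ W j ≤ W i), ha' i,
        map_mul, map_pow, Sections.res_res]
      congr 2
      change Sections.res f _ (Sections.res f _ s) = _
      rw [Sections.res_res]
    rw [map_sub, e1, cechD0_apply, map_sub, eaj, eai, ← mul_sub, hbij, sub_self]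
  -- torsion on the affine `U i ∩ U j`: `(s|)^m * e i j = 0`
  have htors : ∀ i j, ∃ m : ℕ, Sections.res f (hUU i j) s ^ m *
      ((y ^ N • (z : CechC1 f U)) i j - cechD0 f U a' i j) = 0 := by
    intro i j
    refine exists_pow_mul_eq_zero f (hU2 i j) (Sections.res f (hUU i j) s) _ (hWW i j) ?_
      (hvanish i j)
    -- `D(s|_{U i ∩ U j}) ≤ W i ∩ W j`
    rw [Sections.res_apply, Scheme.basicOpen_res, hWeq, hWeq]
    exact le_inf (inf_le_inf inf_le_left le_rfl) (inf_le_inf inf_le_right le_rfl)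
  choose m hm using htors
  obtain ⟨M, hM⟩ : ∃ M, ∀ i j, m i j ≤ M :=
    ⟨Finset.univ.sup fun p : ι × ι => m p.1 p.2,
      fun i j => Finset.le_sup (f := fun p : ι × ι => m p.1 p.2) (Finset.mem_univ (i, j))⟩
  -- conclusion: `y^(M+N) • z = d⁰ (y^M • a')`
  refine ⟨M + N, ?_⟩
  rw [← map_smul, CechH1.mk_eq_zero_iff, mem_cechB1_iff]
  refine ⟨y ^ M • a', ?_⟩
  funext i j
  have key : Sections.res f (hUU i j) s ^ M *
      ((y ^ N • (z : CechC1 f U)) i j - cechD0 f U a' i j) = 0 := by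
    have := hm i j
    calc Sections.res f (hUU i j) s ^ M * ((y ^ N • (z : CechC1 f U)) i j - cechD0 f U a' i j)
        = Sections.res f (hUU i j) s ^ (M - m i j) * (Sections.res f (hUU i j) s ^ m i j *
            ((y ^ N • (z : CechC1 f U)) i j - cechD0 f U a' i j)) := by
          rw [← mul_assoc, ← pow_add, Nat.sub_add_cancel (hM i j)]
      _ = 0 := by rw [this, mul_zero]
  have hsM : (algebraMapΓ f (y ^ M) : Sections f ⊤) = s ^ M := map_pow (algebraMapΓ f) y M
  have lhs : cechD0 f U (y ^ M • a') i j =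
      Sections.res f (hUU i j) s ^ M * cechD0 f U a' i j := by
    rw [map_smul, smul_cechC1_apply, hsM, map_pow]
  have rhs : ((y ^ (M + N) • z : cechZ1 f U) : CechC1 f U) i j =
      Sections.res f (hUU i j) s ^ M * (y ^ N • (z : CechC1 f U)) i j := by
    rw [Submodule.coe_smul, pow_add, mul_smul, smul_cechC1_apply, hsM, map_pow]
  rw [lhs, rhs]
  rw [mul_sub] at key
  exact (sub_eq_zero.mp key).symm

end Literature.AlgebraicGeometry.Morphisms

end
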